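import Summits.ResolutionOfSingularities.ResolutionOfSingularities.Theorems.HilbertSamuelEliminationCampaignW42Theorem314NumericalOfDirDimEq
import Literature.AlgebraicGeometry.CossartJannsenSaito2020.NearPointProjDirectrix
import HarnessLib

/-!
# [OURS · L1 W4.2] The `e = ē` doors in the exact BINDER SHAPES of chain w42 — `Moving.Theorem314_geomDir` (numerical 3.14, general
# centre) and `Thm314_point_locus` (locus 3.14, point centre) with their characteristic clause replaced by `e_x(X) = ē_x(X)`, proved
# outright (campaign s42, cell res-hironaka; informal crux `RidgeConfinement`, stmt-ResolutionOfSingularities-17845; consumers in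
# crux chain w42, stmt-ResolutionOfSingularities-19249; `--supports`)

HONEST FRAMING. OURS (slot W4.2, prover res-L1-s42-pv-1, gen 4). Chain w42 consumes CJS Thm. 3.14 through binders of fixed shape:
`Moving.Theorem314_geomDir` (…MovingTwoDefs :128; `∀ X X' π D N x' x, IsExcellent X → IsPermissible D → IsBlowup π D → dim X ≤ N →
π x' = x → x ∈ V(D) → GeomDirHypothesis X x → H(x') = H(x) → dim 𝒪_{D,x} < e_x(X)`) and `Thm314_point_locus`
(…NearPointProjDirectrix :99; point centre, `CharHypothesis X x`, conclusion `IsOnProjDirectrix π x'`). This file states and PROVES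
the twins obtained by replacing the characteristic clause (`GeomDirHypothesis` / `CharHypothesis`) by CJS's (F3) clause
`Scheme.dirDim X x = Scheme.geomDirDim X x`, with ALL OTHER BINDERS IN THE SAME ORDER — so a consumer holding `e = ē` at the point
(units: Def. 6.38 (i)/(vi), `IsFundamentalUnit.dirDim_eq/geomDirDim_eq`; perfect residue fields: `dirDim_eq_geomDirDim_of_perfectField`)
swaps the binder for a theorem by editing one argument:

* `theorem314_shape_of_dirDim_eq_geomDirDim` — from `theorem314_numerical_of_dirDim_eq_geomDirDim` (p525975);
* `thm314_point_locus_shape_of_dirDim_eq_geomDirDim` — from `isOnProjDirectrix_of_isNearPoint_of_dirDim_eq_geomDirDim` (p518570).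

Fact-free, every characteristic. NOTHING here is a statement of H. Hironaka's manuscript [Hironaka2017]. AI review is weaker than
expert review. References (orientation only): V. Cossart, U. Jannsen, S. Saito, LNM 2270 (2020), Thm. 3.14, §6.3 (F3).
-/

noncomputable section

-- single-conjunct summit: the doubled namespace component `ResolutionOfSingularities` is mandated
set_option linter.dupNamespace false

open CategoryTheory AlgebraicGeometry TopologicalSpace IsLocalRing
open Literature.AlgebraicGeometry.Resolution Literature.RingTheory.HilbertSamuel
open Literature.AlgebraicGeometry.CossartJannsenSaito2020

namespace Summit.ResolutionOfSingularities.ResolutionOfSingularities.Theorems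

namespace CampaignW42

universe u

/-- **`Moving.Theorem314_geomDir` with `GeomDirHypothesis X x` replaced by `e_x(X) = ē_x(X)`, PROVED**: for `X` excellent,
`D` permissible, `π` a blow-up in `D`, `N ≥ dim X`, `x'` over `x ∈ V(D)` with `e_x(X) = ē_x(X)` and `H^N(x') = H^N(x)`:
`dim 𝒪_{D,x} < e_x(X)`. Same binder order as the w42 binder (the `dim X ≤ N` binder is accepted and unused).
[cite: CossartJannsenSaito2020, Thm. 3.14, §6.3 (F3)] -/
theorem theorem314_shape_of_dirDim_eq_geomDirDim :
    ∀ (X X' : Scheme.{u}) [IsLocallyNoetherian X] [IsLocallyNoetherian X'] (π : X' ⟶ X) (D : X.IdealSheafData)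
      (N : ℕ) (x' : X') (x : X),
      Scheme.IsExcellent X → IdealSheafData.IsPermissible D → IsBlowup π D →
      topologicalKrullDim X ≤ (N : WithBot ℕ∞) → π.base x' = x → x ∈ (D.support : Set X) →
      Scheme.dirDim X x = Scheme.geomDirDim X x →
      Scheme.hsFun X' N x' = Scheme.hsFun X N x →
        ringKrullDim (X.presheaf.stalk x ⧸ stalkIdeal D x) < (Scheme.dirDim X x : WithBot ℕ∞) := by
  intro X X' _ _ π D N x' x hX hD hπ _ hxx' hxD he hnear
  subst hxx'
  exact theorem314_numerical_of_dirDim_eq_geomDirDim hX hD hπ x' hxD he hnear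

/-- **`Thm314_point_locus` with `CharHypothesis X x` replaced by `e_x(X) = ē_x(X)`, PROVED**: for `X` excellent and locally
noetherian, `x` a closed point whose reduced subscheme is a permissible centre, `π` a blow-up in `{x}`, `N ≥ dim X`, `x'` over `x`
with `e_x(X) = ē_x(X)` and `H^N(x') = H^N(x)`: `IsOnProjDirectrix π x'`. Same binder order as the print binder (the `dim X ≤ N`
and closedness binders are accepted; permissibility is used only through `IsPermissibleAt`).
[cite: CossartJannsenSaito2020, Thm. 3.14, Def. 6.38 (i)] -/
theorem thm314_point_locus_shape_of_dirDim_eq_geomDirDim :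
    ∀ (X X' : Scheme.{u}) [IsLocallyNoetherian X] (π : X' ⟶ X) (x : X) (hx : IsClosed ({x} : Set X)) (N : ℕ)
      (x' : X'),
      Scheme.IsExcellent X →
      IdealSheafData.IsPermissible (Scheme.IdealSheafData.vanishingIdeal ⟨{x}, hx⟩) →
      IsBlowup π (Scheme.IdealSheafData.vanishingIdeal ⟨{x}, hx⟩) →
      topologicalKrullDim ↥X ≤ (N : WithBot ℕ∞) → π.base x' = x →
      Scheme.dirDim X x = Scheme.geomDirDim X x →
      Scheme.hsFun X' N x' = Scheme.hsFun X N x → IsOnProjDirectrix π x' := by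
  intro X X' _ π x hx N x' hX hperm hπ _ hxx' he hnear
  subst hxx'
  have hsupp : π.base x' ∈ ((Scheme.IdealSheafData.vanishingIdeal ⟨{π.base x'}, hx⟩).support : Set X) := by
    rw [Scheme.IdealSheafData.coe_support_vanishingIdeal]
    exact Set.mem_singleton _
  exact isOnProjDirectrix_of_isNearPoint_of_dirDim_eq_geomDirDim hπ x' (hperm _ hsupp)
    (hX.isUniversallyCatenaryRing_stalk _) (stalkIdeal_vanishingIdeal_singleton hx) he (N := N) hnear

end CampaignW42

end Summit.ResolutionOfSingularities.ResolutionOfSingularities.Theorems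

end
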